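import Summits.Ventures.PercRepro.RankLevelSetLevelSixT22Cell7
import Summits.Ventures.PercRepro.RankLevelSetLevelSixT22Cell8
import Summits.Ventures.PercRepro.RankLevelSetLevelSixT22Cell9
import Summits.Ventures.PercRepro.RankLevelSetLevelSixT22Cell10
import Summits.Ventures.PercRepro.RankLevelSetLevelSixT22Cell13
import Summits.Ventures.PercRepro.RankLevelSetLevelSixT22Cell14
import Summits.Ventures.PercRepro.RankLevelSetLevelSixT22Cell15
import Summits.Ventures.PercRepro.RankLevelSetLevelSixT22Cell16
import Summits.Ventures.PercRepro.RankLevelSetLevelSixT22Cell17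
import Summits.Ventures.PercRepro.RankLevelSetLevelSixT22Cell18
import Summits.Ventures.PercRepro.RankLevelSetLevelSixT22Cell19
import Summits.Ventures.PercRepro.RankLevelSetLevelSixT22Cell20
import Summits.Ventures.PercRepro.RankLevelSetLevelSixT22BasisMid1
import Summits.Ventures.PercRepro.RankLevelSetLevelSixT22BasisMid2
import Summits.Ventures.PercRepro.RankLevelSetLevelSixT22BasisMid3
import Summits.Ventures.PercRepro.RankLevelSetLevelSixT22RegII
import Summits.Ventures.PercRepro.RankLevelSetLevelSixT23Assembly

/-!
# PercRepro — THE 22 ROW MODULO ITS TWO HOLES `(22, 11)` AND `(22, 12)`: the assembly (p8 g13, S3)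

`c025_core_six_twentytwo_of`: every `e`-free core of rank `22` satisfies `RLS M 22 6` PROVIDED the cells `(22, 11)` and `(22, 12)`
do (`h11`, `h12`); every other corank is a theorem: `(22, 7)`, `(22, 8)` (g12), `(22, 9)`, `(22, 10)`, `(22, 13)` … `(22, 20)` (the coloop
device), `(22, 21)` … `(22, 39)` (the basis cells `c025_core_six_t22_basis_mid1/2/3`), `(22, d ≥ 40)` (regime II
`c025_core_six_regII_basis_22`). Then the level-5 glue as in the 23 row: `c025_six_of_five_t22_of` (level `5` for all `p ≥ 21` ⟹
level `6` for all `p ≥ 22`, by `rls_six_at_of_core 22` and the 23 row) and `c025_six_large_twenty_two_of` on p7's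
`c025_five_large_sharp19`. NOT a theorem of the row: the two hypotheses are the row's exact gap. Axioms: standard.
-/

open scoped Matroid

namespace PercRepro

namespace ThmN

variable {α : Type}

/-- **The core cell `(22, d)` at every corank `d ≥ 21`, every `e`-free core** (the basis cells and regime II). -/
theorem c025_core_six_twentytwo_large (M : Matroid α) [M.Finite] (d : ℕ) (hd21 : 21 ≤ d)
    (hR : M.eRank = (22 : ℕ∞)) (hn : M.E.ncard = 22 + d)
    (hfree : ∀ e ∈ M.E, ∃ A ⊆ M.E \ {e}, e ∉ M.closure A ∧ e ∉ M.closure ((M.E \ {e}) \ A)) :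
    RLS M 22 6 := by
  rcases Nat.lt_or_ge d 30 with h29 | h30
  · exact c025_core_six_t22_basis_mid1 M d hd21 (by omega) hR hn hfree
  rcases Nat.lt_or_ge d 39 with h38 | h39
  · exact c025_core_six_t22_basis_mid2 M d h30 (by omega) hR hn hfree
  rcases Nat.lt_or_ge d 40 with h39' | h40
  · exact c025_core_six_t22_basis_mid3 M d h39 (by omega) hR hn hfree
  · exact c025_core_six_regII_basis_22 M d h40 hR hn hfree

/-- **The core cell `(22, d)` at every corank `d ≥ 7`, every `e`-free core — MODULO the cells `(22, 11)` and `(22, 12)`.** -/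
theorem c025_core_six_twentytwo_of (M : Matroid α) [M.Finite] (d : ℕ) (hd7 : 7 ≤ d)
    (hR : M.eRank = (22 : ℕ∞)) (hn : M.E.ncard = 22 + d)
    (hfree : ∀ e ∈ M.E, ∃ A ⊆ M.E \ {e}, e ∉ M.closure A ∧ e ∉ M.closure ((M.E \ {e}) \ A))
    (h11 : ∀ (N : Matroid α) [N.Finite], N.eRank = (22 : ℕ∞) → N.E.ncard = 22 + 11 →
      (∀ e ∈ N.E, ∃ A ⊆ N.E \ {e}, e ∉ N.closure A ∧ e ∉ N.closure ((N.E \ {e}) \ A)) → RLS N 22 6)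
    (h12 : ∀ (N : Matroid α) [N.Finite], N.eRank = (22 : ℕ∞) → N.E.ncard = 22 + 12 →
      (∀ e ∈ N.E, ∃ A ⊆ N.E \ {e}, e ∉ N.closure A ∧ e ∉ N.closure ((N.E \ {e}) \ A)) → RLS N 22 6) :
    RLS M 22 6 := by
  rcases Nat.lt_or_ge d 21 with hlt | hge
  · interval_cases d
    · exact c025_core_six_twentytwo_7 M hR hn hfree
    · exact c025_core_six_twentytwo_8 M hR hn hfree
    · exact c025_core_six_twentytwo_9 M hR hn hfree
    · exact c025_core_six_twentytwo_10 M hR hn hfree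
    · exact h11 M hR hn hfree
    · exact h12 M hR hn hfree
    · exact c025_core_six_twentytwo_13 M hR hn hfree
    · exact c025_core_six_twentytwo_14 M hR hn hfree
    · exact c025_core_six_twentytwo_15 M hR hn hfree
    · exact c025_core_six_twentytwo_16 M hR hn hfree
    · exact c025_core_six_twentytwo_17 M hR hn hfree
    · exact c025_core_six_twentytwo_18 M hR hn hfree
    · exact c025_core_six_twentytwo_19 M hR hn hfree
    · exact c025_core_six_twentytwo_20 M hR hn hfree
  · exact c025_core_six_twentytwo_large M d hge hR hn hfree

/-- **THEOREM C₆ AT RANK `22`, GIVEN LEVEL `5` AND THE TWO HOLES**: level `5` for all `p ≥ 21` implies level `6` for all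
`p ≥ 22` (`p = 22` by the cells and `rls_six_at_of_core`; `p ≥ 23` by the 23 row). -/
theorem c025_six_of_five_t22_of
    (h11 : ∀ (N : Matroid α) [N.Finite], N.eRank = (22 : ℕ∞) → N.E.ncard = 22 + 11 →
      (∀ e ∈ N.E, ∃ A ⊆ N.E \ {e}, e ∉ N.closure A ∧ e ∉ N.closure ((N.E \ {e}) \ A)) → RLS N 22 6)
    (h12 : ∀ (N : Matroid α) [N.Finite], N.eRank = (22 : ℕ∞) → N.E.ncard = 22 + 12 →
      (∀ e ∈ N.E, ∃ A ⊆ N.E \ {e}, e ∉ N.closure A ∧ e ∉ N.closure ((N.E \ {e}) \ A)) → RLS N 22 6)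
    (h5 : ∀ (M : Matroid α) [M.Finite] (p : ℕ), 21 ≤ p → RLS M p 5) :
    ∀ (M : Matroid α) [M.Finite] (p : ℕ), 22 ≤ p → RLS M p 6 := by
  intro M _ p hp
  rcases Nat.lt_or_ge p 23 with hlt | hge
  · have hP : p = 22 := by omega
    subst hP
    refine rls_six_at_of_core 22 (by norm_num) (fun M _ => h5 M 21 (by norm_num)) ?_ M
    intro M _ d hd hR hn hfree
    exact c025_core_six_twentytwo_of M d hd hR hn hfree h11 h12
  · exact c025_six_large_twenty_three M p hge

/-- **C-025 AT LEVEL `6` FOR EVERY `p ≥ 22`, MODULO THE TWO HOLES** — on p7's `c025_five_large_sharp19 (19 ≤ p)`. -/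
theorem c025_six_large_twenty_two_of
    (h11 : ∀ (N : Matroid α) [N.Finite], N.eRank = (22 : ℕ∞) → N.E.ncard = 22 + 11 →
      (∀ e ∈ N.E, ∃ A ⊆ N.E \ {e}, e ∉ N.closure A ∧ e ∉ N.closure ((N.E \ {e}) \ A)) → RLS N 22 6)
    (h12 : ∀ (N : Matroid α) [N.Finite], N.eRank = (22 : ℕ∞) → N.E.ncard = 22 + 12 →
      (∀ e ∈ N.E, ∃ A ⊆ N.E \ {e}, e ∉ N.closure A ∧ e ∉ N.closure ((N.E \ {e}) \ A)) → RLS N 22 6)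
    (M : Matroid α) [M.Finite] (p : ℕ) (hp : 22 ≤ p) : RLS M p 6 :=
  c025_six_of_five_t22_of h11 h12 (fun M _ p hp => c025_five_large_sharp19 M p (by omega)) M p hp

end ThmN

end PercRepro
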